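import Mathlib
import Summits.CriticalPhenomena.Ising3DConformalLimit.Theorems.PrecisionLaplacianEtaBoundsTransferPotential
import Literature.Probability.LatticeModels.DiscreteParseval
import HarnessLib

/-!
# Limits along boxes: `(M Λ_n)⁻¹ 0 0 ↑ A₀`, `−(M Λ_n)⁻¹ 0 y ↓ a(y)`, summability of `a`

Helper file for item `stmt-CriticalPhenomena-4804`
(`Summit.CriticalPhenomena.Ising3DConformalLimit.Theses.PrecisionLaplacian.EtaBoundsTransfer`), part of its
unconditional proof: potential theory of inverse M-matrices ⇒ infinite-volume equation and Green-function
representation; Fourier analysis on `[-π,π]^d` ⇒ block-sum upper bounds; quadratic test function ⇒ ball-sum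
lower bounds; Messager–Miracle-Solé ⇒ pointwise two-sided power bounds. No definitions are introduced: the
objects (kernel matrices, box sequences, convolution powers) enter through defining hypotheses.
-/

namespace Summit.CriticalPhenomena.Ising3DConformalLimit.Theorems.EtaBoundsTransfer

open Matrix Finset Filter Topology Literature.Probability.LatticeModels
open scoped NNReal

section Limit

variable {d : ℕ} {G : Site d → ℝ} {M : (A : Finset (Site d)) → Matrix A A ℝ}
  {k : ℕ → ℝ} {t : ℕ → Site d → ℝ} {a : Site d → ℝ}

/-- Every finite set of sites lies in some box. -/
theorem exists_subset_box' (A : Finset (Site d)) : ∃ N, A ⊆ box d N :=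
  ⟨A.sup Site.supNorm, fun _ hx => mem_box_iff_supNorm_le.2 (Finset.le_sup (f := Site.supNorm) hx)⟩

/-- If `G → 0` at infinity then `sup_{y ≠ 0} G y < G 0`: there is `0 ≤ s < G 0` with `G y ≤ s`
for all `y ≠ 0`. -/
theorem exists_offDiag_bound
    (hM : ∀ A, M A = Matrix.of fun (p q : ↥A) => G (q.1 - p.1))
    (hSP : ∀ A : Finset (Site d), (M A).PosDef ∧
      ∀ u v : ↥A, (u ≠ v → (M A)⁻¹ u v ≤ 0) ∧ 0 ≤ ∑ w, (M A)⁻¹ u w)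
    (hGto : Tendsto G cofinite (𝓝 0)) :
    ∃ s : ℝ, 0 ≤ s ∧ s < G 0 ∧ ∀ y, y ≠ 0 → G y ≤ s := by
  have hG0 := apply_zero_pos hM hSP
  have hev : ∀ᶠ y in cofinite, G y < G 0 / 2 :=
    hGto.eventually (gt_mem_nhds (show (0:ℝ) < G 0 / 2 by linarith))
  have hfin : {y : Site d | G 0 / 2 ≤ G y}.Finite := by
    have := Filter.eventually_cofinite.1 hev
    simpa [not_lt] using this
  set F : Finset (Site d) := hfin.toFinset.erase 0 with hF
  set m : ℝ≥0 := F.sup fun y => (G y).toNNReal with hm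
  refine ⟨max (G 0 / 2) (m : ℝ), le_max_of_le_left (by linarith), max_lt (by linarith) ?_, ?_⟩
  · have hlt : m < (G 0).toNNReal := by
      rw [hm, Finset.sup_lt_iff (show (⊥ : ℝ≥0) < (G 0).toNNReal by
        rw [bot_eq_zero]; exact Real.toNNReal_pos.2 hG0)]
      intro y hy
      have hy0 : y ≠ 0 := (Finset.mem_erase.1 hy).1
      exact (Real.toNNReal_lt_toNNReal_iff hG0).2 (apply_lt_apply_zero hM hSP hy0)
    have := NNReal.coe_lt_coe.2 hlt
    rwa [Real.coe_toNNReal _ hG0.le] at this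
  · intro y hy0
    by_cases hy : G 0 / 2 ≤ G y
    · have hyF : y ∈ F := Finset.mem_erase.2 ⟨hy0, hfin.mem_toFinset.2 hy⟩
      have h1 : (G y).toNNReal ≤ m := Finset.le_sup (f := fun y => (G y).toNNReal) hyF
      have h2 : G y ≤ (m : ℝ) := by
        have := NNReal.coe_le_coe.2 h1
        rwa [Real.coe_toNNReal _ (apply_nonneg hM hSP y)] at this
      exact h2.trans (le_max_right _ _)
    · exact (le_of_lt (not_le.1 hy)).trans (le_max_left _ _)

/-! ### The diagonal entries along boxes: `k n = (M Λ_n)⁻¹ 0 0 ↑ A₀` -/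

/-- `k n = (M Λ_n)⁻¹ 0 0` is monotone in `n`. -/
theorem k_mono
    (hM : ∀ A, M A = Matrix.of fun (p q : ↥A) => G (q.1 - p.1))
    (hSP : ∀ A : Finset (Site d), (M A).PosDef ∧
      ∀ u v : ↥A, (u ≠ v → (M A)⁻¹ u v ≤ 0) ∧ 0 ≤ ∑ w, (M A)⁻¹ u w)
    (hk : ∀ n, k n = (M (box d n))⁻¹ ⟨0, zero_mem_box d n⟩ ⟨0, zero_mem_box d n⟩) :
    Monotone k := by
  intro n m hnm
  rw [hk n, hk m]
  exact inv_kerMat_mono hM hSP (box_mono d hnm) _ _ _ _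

/-- `k n ≥ 1 / G 0 > 0`. -/
theorem k_ge
    (hM : ∀ A, M A = Matrix.of fun (p q : ↥A) => G (q.1 - p.1))
    (hSP : ∀ A : Finset (Site d), (M A).PosDef ∧
      ∀ u v : ↥A, (u ≠ v → (M A)⁻¹ u v ≤ 0) ∧ 0 ≤ ∑ w, (M A)⁻¹ u w)
    (hk : ∀ n, k n = (M (box d n))⁻¹ ⟨0, zero_mem_box d n⟩ ⟨0, zero_mem_box d n⟩) (n : ℕ) :
    1 / G 0 ≤ k n := by
  rw [hk n]; exact inv_apply_zero_zero_ge hM hSP _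

/-- **Existence of `A₀ = lim (M Λ_n)⁻¹ 0 0`**: the diagonal entries along boxes are monotone and
bounded (by `1/(G 0 − s)`), hence converge to some `A₀ > 0` dominating every `k n`. -/
theorem exists_A0
    (hM : ∀ A, M A = Matrix.of fun (p q : ↥A) => G (q.1 - p.1))
    (hSP : ∀ A : Finset (Site d), (M A).PosDef ∧
      ∀ u v : ↥A, (u ≠ v → (M A)⁻¹ u v ≤ 0) ∧ 0 ≤ ∑ w, (M A)⁻¹ u w)
    (hGto : Tendsto G cofinite (𝓝 0))
    (hk : ∀ n, k n = (M (box d n))⁻¹ ⟨0, zero_mem_box d n⟩ ⟨0, zero_mem_box d n⟩) :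
    ∃ A₀ : ℝ, Tendsto k atTop (𝓝 A₀) ∧ (∀ n, k n ≤ A₀) ∧ 0 < A₀ := by
  obtain ⟨s, hs0, hsG, hs⟩ := exists_offDiag_bound hM hSP hGto
  have hbdd : BddAbove (Set.range k) := by
    refine ⟨1 / (G 0 - s), ?_⟩
    rintro _ ⟨n, rfl⟩
    rw [hk n]
    exact inv_apply_zero_zero_le hM hSP _ hs0 hs hsG
  refine ⟨⨆ n, k n, tendsto_atTop_ciSup (k_mono hM hSP hk) hbdd, fun n => le_ciSup hbdd n, ?_⟩
  have h1 := k_ge hM hSP hk 0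
  have h2 : 0 < 1 / G 0 := by have := apply_zero_pos hM hSP; positivity
  exact lt_of_lt_of_le (lt_of_lt_of_le h2 h1) (le_ciSup hbdd 0)

/-! ### The off-diagonal entries along boxes: `t n y = −(M Λ_n)⁻¹ 0 y ↓ a y` -/

/-- `t n 0 = -k n`. -/
theorem t_zero
    (hk : ∀ n, k n = (M (box d n))⁻¹ ⟨0, zero_mem_box d n⟩ ⟨0, zero_mem_box d n⟩)
    (ht : ∀ n y (hy : y ∈ box d n), t n y = -(M (box d n))⁻¹ ⟨0, zero_mem_box d n⟩ ⟨y, hy⟩)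
    (n : ℕ) : t n 0 = -k n := by
  rw [ht n 0 (zero_mem_box d n), hk n]

/-- `t n y ≥ 0` for `y ≠ 0` in the box (Z-sign pattern). -/
theorem t_nonneg
    (hSP : ∀ A : Finset (Site d), (M A).PosDef ∧
      ∀ u v : ↥A, (u ≠ v → (M A)⁻¹ u v ≤ 0) ∧ 0 ≤ ∑ w, (M A)⁻¹ u w)
    (ht : ∀ n y (hy : y ∈ box d n), t n y = -(M (box d n))⁻¹ ⟨0, zero_mem_box d n⟩ ⟨y, hy⟩)
    {n : ℕ} {y : Site d} (hy0 : y ≠ 0) (hy : y ∈ box d n) : 0 ≤ t n y := by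
  rw [ht n y hy, neg_nonneg]
  exact ((hSP (box d n)).2 _ _).1 (fun h => hy0 (congrArg Subtype.val h).symm)

/-- `t n (-y) = t n y` (reflection symmetry of the box). -/
theorem t_neg
    (hM : ∀ A, M A = Matrix.of fun (p q : ↥A) => G (q.1 - p.1))
    (hSP : ∀ A : Finset (Site d), (M A).PosDef ∧
      ∀ u v : ↥A, (u ≠ v → (M A)⁻¹ u v ≤ 0) ∧ 0 ≤ ∑ w, (M A)⁻¹ u w)
    (ht : ∀ n y (hy : y ∈ box d n), t n y = -(M (box d n))⁻¹ ⟨0, zero_mem_box d n⟩ ⟨y, hy⟩)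
    {n : ℕ} {y : Site d} (hy : y ∈ box d n) : t n (-y) = t n y := by
  rw [ht n y hy, ht n (-y) (neg_mem_box hy)]
  have h := inv_kerMat_neg hM hSP (A := box d n) (fun x hx => neg_mem_box hx) (zero_mem_box d n) hy
  simp only [neg_zero] at h
  rw [h]

/-- The off-diagonal mass of row `0` is bounded by the diagonal entry:
`∑_{y ∈ Λ_n ∖ 0} t n y ≤ k n`. -/
theorem sum_t_le_k
    (hSP : ∀ A : Finset (Site d), (M A).PosDef ∧
      ∀ u v : ↥A, (u ≠ v → (M A)⁻¹ u v ≤ 0) ∧ 0 ≤ ∑ w, (M A)⁻¹ u w)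
    (hk : ∀ n, k n = (M (box d n))⁻¹ ⟨0, zero_mem_box d n⟩ ⟨0, zero_mem_box d n⟩)
    (ht : ∀ n y (hy : y ∈ box d n), t n y = -(M (box d n))⁻¹ ⟨0, zero_mem_box d n⟩ ⟨y, hy⟩)
    (n : ℕ) : ∑ y ∈ (box d n).erase 0, t n y ≤ k n := by
  have h := sum_neg_inv_le_diag hSP (A := box d n) (zero_mem_box d n)
  rw [hk n]
  refine le_trans (le_of_eq ?_) h
  -- convert the sum over `(box d n).erase 0` into the sum over the subtype minus the point `0`
  have h1 : ∑ w : ↥(box d n), t n w.1 = ∑ y ∈ box d n, t n y := Finset.sum_coe_sort _ _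
  have h2 : ∀ w : ↥(box d n), t n w.1 = -(M (box d n))⁻¹ ⟨0, zero_mem_box d n⟩ w := by
    intro w; rw [ht n w.1 w.2]
  rw [← Finset.sum_erase_add _ _ (Finset.mem_univ (⟨0, zero_mem_box d n⟩ : ↥(box d n)))] at h1
  rw [← Finset.sum_erase_add _ _ (zero_mem_box d n)] at h1
  simp only [h2] at h1
  have h3 : t n 0 = -(M (box d n))⁻¹ ⟨0, zero_mem_box d n⟩ ⟨0, zero_mem_box d n⟩ :=
    ht n 0 (zero_mem_box d n)
  linarith

/-- The set over which the infimum defining `a y` is taken is nonempty. -/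
theorem nonempty_index (y : Site d) :
    Nonempty {A : Finset (Site d) // (0 : Site d) ∈ A ∧ y ∈ A} :=
  ⟨⟨{0, y}, by simp, by simp⟩⟩

/-- The terms of the infimum defining `a y` are nonnegative for `y ≠ 0`. -/
theorem bddBelow_index
    (hSP : ∀ A : Finset (Site d), (M A).PosDef ∧
      ∀ u v : ↥A, (u ≠ v → (M A)⁻¹ u v ≤ 0) ∧ 0 ≤ ∑ w, (M A)⁻¹ u w)
    {y : Site d} (hy0 : y ≠ 0) :
    BddBelow (Set.range fun A : {A : Finset (Site d) // (0 : Site d) ∈ A ∧ y ∈ A} =>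
      -((M A.1)⁻¹ ⟨0, A.2.1⟩ ⟨y, A.2.2⟩)) := by
  refine ⟨0, ?_⟩
  rintro _ ⟨A, rfl⟩
  rw [neg_nonneg]
  exact ((hSP A.1).2 _ _).1 (fun h => hy0 (congrArg Subtype.val h).symm)

/-- `a y ≥ 0` for `y ≠ 0`. -/
theorem a_nonneg
    (hSP : ∀ A : Finset (Site d), (M A).PosDef ∧
      ∀ u v : ↥A, (u ≠ v → (M A)⁻¹ u v ≤ 0) ∧ 0 ≤ ∑ w, (M A)⁻¹ u w)
    (ha : ∀ y, a y = ⨅ A : {A : Finset (Site d) // (0 : Site d) ∈ A ∧ y ∈ A},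
      -((M A.1)⁻¹ ⟨0, A.2.1⟩ ⟨y, A.2.2⟩))
    {y : Site d} (hy0 : y ≠ 0) : 0 ≤ a y := by
  rw [ha y]
  haveI := nonempty_index (d := d) y
  refine le_ciInf fun A => ?_
  rw [neg_nonneg]
  exact ((hSP A.1).2 _ _).1 (fun h => hy0 (congrArg Subtype.val h).symm)

/-- `a y ≤ t n y` whenever `y ≠ 0` lies in the box `Λ_n`. -/
theorem a_le_t
    (hSP : ∀ A : Finset (Site d), (M A).PosDef ∧
      ∀ u v : ↥A, (u ≠ v → (M A)⁻¹ u v ≤ 0) ∧ 0 ≤ ∑ w, (M A)⁻¹ u w)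
    (ht : ∀ n y (hy : y ∈ box d n), t n y = -(M (box d n))⁻¹ ⟨0, zero_mem_box d n⟩ ⟨y, hy⟩)
    (ha : ∀ y, a y = ⨅ A : {A : Finset (Site d) // (0 : Site d) ∈ A ∧ y ∈ A},
      -((M A.1)⁻¹ ⟨0, A.2.1⟩ ⟨y, A.2.2⟩))
    {n : ℕ} {y : Site d} (hy0 : y ≠ 0) (hy : y ∈ box d n) : a y ≤ t n y := by
  rw [ha y, ht n y hy]
  exact ciInf_le (bddBelow_index hSP hy0) ⟨box d n, zero_mem_box d n, hy⟩

/-- For `y ≠ 0` and `ε > 0`, eventually `t n y ≤ a y + ε` (the infimum over all finite sets is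
approached along boxes, by monotonicity). -/
theorem t_eventually_le
    (hM : ∀ A, M A = Matrix.of fun (p q : ↥A) => G (q.1 - p.1))
    (hSP : ∀ A : Finset (Site d), (M A).PosDef ∧
      ∀ u v : ↥A, (u ≠ v → (M A)⁻¹ u v ≤ 0) ∧ 0 ≤ ∑ w, (M A)⁻¹ u w)
    (ht : ∀ n y (hy : y ∈ box d n), t n y = -(M (box d n))⁻¹ ⟨0, zero_mem_box d n⟩ ⟨y, hy⟩)
    (ha : ∀ y, a y = ⨅ A : {A : Finset (Site d) // (0 : Site d) ∈ A ∧ y ∈ A},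
      -((M A.1)⁻¹ ⟨0, A.2.1⟩ ⟨y, A.2.2⟩))
    (y : Site d) {ε : ℝ} (hε : 0 < ε) :
    ∀ᶠ n in atTop, t n y ≤ a y + ε := by
  haveI := nonempty_index (d := d) y
  have hlt : (⨅ A : {A : Finset (Site d) // (0 : Site d) ∈ A ∧ y ∈ A},
      -((M A.1)⁻¹ ⟨0, A.2.1⟩ ⟨y, A.2.2⟩)) < a y + ε := by rw [← ha y]; linarith
  obtain ⟨A, hA⟩ := exists_lt_of_ciInf_lt hlt
  obtain ⟨N, hN⟩ := exists_subset_box' A.1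
  filter_upwards [eventually_ge_atTop N] with n hn
  have hsub : A.1 ⊆ box d n := hN.trans (box_mono d hn)
  have hy : y ∈ box d n := hsub A.2.2
  rw [ht n y hy]
  have := inv_kerMat_mono hM hSP hsub A.2.1 A.2.2 (zero_mem_box d n) hy
  linarith

/-- **`t n y → a y`** for `y ≠ 0`. -/
theorem tendsto_t
    (hM : ∀ A, M A = Matrix.of fun (p q : ↥A) => G (q.1 - p.1))
    (hSP : ∀ A : Finset (Site d), (M A).PosDef ∧
      ∀ u v : ↥A, (u ≠ v → (M A)⁻¹ u v ≤ 0) ∧ 0 ≤ ∑ w, (M A)⁻¹ u w)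
    (ht : ∀ n y (hy : y ∈ box d n), t n y = -(M (box d n))⁻¹ ⟨0, zero_mem_box d n⟩ ⟨y, hy⟩)
    (ha : ∀ y, a y = ⨅ A : {A : Finset (Site d) // (0 : Site d) ∈ A ∧ y ∈ A},
      -((M A.1)⁻¹ ⟨0, A.2.1⟩ ⟨y, A.2.2⟩))
    {y : Site d} (hy0 : y ≠ 0) : Tendsto (fun n => t n y) atTop (𝓝 (a y)) := by
  rw [tendsto_order]
  constructor
  · intro b hb
    filter_upwards [eventually_ge_atTop (Site.supNorm y)] with n hn
    exact lt_of_lt_of_le hb (a_le_t hSP ht ha hy0 (mem_box_iff_supNorm_le.2 hn))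
  · intro b hb
    filter_upwards [t_eventually_le hM hSP ht ha y (show 0 < (b - a y) / 2 by linarith)]
      with n hn
    linarith

/-- `a (-y) = a y` for `y ≠ 0` (evenness of the direct correlation function). -/
theorem a_neg
    (hM : ∀ A, M A = Matrix.of fun (p q : ↥A) => G (q.1 - p.1))
    (hSP : ∀ A : Finset (Site d), (M A).PosDef ∧
      ∀ u v : ↥A, (u ≠ v → (M A)⁻¹ u v ≤ 0) ∧ 0 ≤ ∑ w, (M A)⁻¹ u w)
    (ht : ∀ n y (hy : y ∈ box d n), t n y = -(M (box d n))⁻¹ ⟨0, zero_mem_box d n⟩ ⟨y, hy⟩)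
    (ha : ∀ y, a y = ⨅ A : {A : Finset (Site d) // (0 : Site d) ∈ A ∧ y ∈ A},
      -((M A.1)⁻¹ ⟨0, A.2.1⟩ ⟨y, A.2.2⟩))
    {y : Site d} (hy0 : y ≠ 0) : a (-y) = a y := by
  have h1 := tendsto_t hM hSP ht ha hy0
  have h2 := tendsto_t hM hSP ht ha (neg_ne_zero.2 hy0)
  have h3 : (fun n => t n (-y)) =ᶠ[atTop] fun n => t n y := by
    filter_upwards [eventually_ge_atTop (Site.supNorm y)] with n hn
    exact t_neg hM hSP ht (mem_box_iff_supNorm_le.2 hn)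
  exact tendsto_nhds_unique (h2.congr' h3) h1

/-- **Uniform mass bound**: every finite partial sum of `a` off the origin is at most `A₀`
(`∑ t n ≤ k n ≤ A₀` and `a ≤ t n`). -/
theorem sum_a_le
    (hSP : ∀ A : Finset (Site d), (M A).PosDef ∧
      ∀ u v : ↥A, (u ≠ v → (M A)⁻¹ u v ≤ 0) ∧ 0 ≤ ∑ w, (M A)⁻¹ u w)
    (hk : ∀ n, k n = (M (box d n))⁻¹ ⟨0, zero_mem_box d n⟩ ⟨0, zero_mem_box d n⟩)
    (ht : ∀ n y (hy : y ∈ box d n), t n y = -(M (box d n))⁻¹ ⟨0, zero_mem_box d n⟩ ⟨y, hy⟩)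
    (ha : ∀ y, a y = ⨅ A : {A : Finset (Site d) // (0 : Site d) ∈ A ∧ y ∈ A},
      -((M A.1)⁻¹ ⟨0, A.2.1⟩ ⟨y, A.2.2⟩))
    {A₀ : ℝ} (hkle : ∀ n, k n ≤ A₀) (F : Finset (Site d)) :
    ∑ y ∈ F, (if y = 0 then 0 else a y) ≤ A₀ := by
  obtain ⟨N, hN⟩ := exists_subset_box' F
  rw [← Finset.sum_erase F (a := 0) (by simp)]
  calc ∑ y ∈ F.erase 0, (if y = 0 then 0 else a y)
      ≤ ∑ y ∈ (box d N).erase 0, (if y = 0 then 0 else a y) := by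
        apply Finset.sum_le_sum_of_subset_of_nonneg
        · intro y hy
          exact Finset.mem_erase.2 ⟨(Finset.mem_erase.1 hy).1, hN (Finset.mem_of_mem_erase hy)⟩
        · intro y _ _
          split_ifs with h
          · exact le_rfl
          · exact a_nonneg hSP ha h
    _ ≤ ∑ y ∈ (box d N).erase 0, t N y := by
        apply Finset.sum_le_sum
        intro y hy
        have hy0 : y ≠ 0 := (Finset.mem_erase.1 hy).1
        rw [if_neg hy0]
        exact a_le_t hSP ht ha hy0 (Finset.mem_of_mem_erase hy)
    _ ≤ k N := sum_t_le_k hSP hk ht N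
    _ ≤ A₀ := hkle N

/-- **Summability of the direct correlation function** `a' = 𝟙_{≠0} a` and the mass bound
`∑' a' ≤ A₀`. -/
theorem summable_a
    (hSP : ∀ A : Finset (Site d), (M A).PosDef ∧
      ∀ u v : ↥A, (u ≠ v → (M A)⁻¹ u v ≤ 0) ∧ 0 ≤ ∑ w, (M A)⁻¹ u w)
    (hk : ∀ n, k n = (M (box d n))⁻¹ ⟨0, zero_mem_box d n⟩ ⟨0, zero_mem_box d n⟩)
    (ht : ∀ n y (hy : y ∈ box d n), t n y = -(M (box d n))⁻¹ ⟨0, zero_mem_box d n⟩ ⟨y, hy⟩)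
    (ha : ∀ y, a y = ⨅ A : {A : Finset (Site d) // (0 : Site d) ∈ A ∧ y ∈ A},
      -((M A.1)⁻¹ ⟨0, A.2.1⟩ ⟨y, A.2.2⟩))
    {A₀ : ℝ} (hkle : ∀ n, k n ≤ A₀) :
    Summable (fun y => if y = 0 then 0 else a y) ∧
      ∑' y, (if y = 0 then 0 else a y) ≤ A₀ := by
  have hnn : ∀ y, 0 ≤ (if y = 0 then 0 else a y) := by
    intro y; split_ifs with h
    · exact le_rfl
    · exact a_nonneg hSP ha h
  have hs : Summable (fun y => if y = 0 then 0 else a y) :=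
    summable_of_sum_le hnn (sum_a_le hSP hk ht ha hkle)
  exact ⟨hs, hs.tsum_le_of_sum_le (sum_a_le hSP hk ht ha hkle)⟩

end Limit

end Summit.CriticalPhenomena.Ising3DConformalLimit.Theorems.EtaBoundsTransfer
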